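import Summits.HodgeConjecture.HodgeConjecture.Theorems.F0P3cStCharTSRootPersist   -- ★ P1 `exists_root_near_of_simple_root` (+ ★ RootCalculus `exists_root_unique_near`)
import HarnessLib

/-!
# F0 · P3c · line LH6 «StCharTS» — «MOVING-ROOT★»: a simple root of a continuously varying polynomial moves continuously
# (complete normed field; filter-language packaging of ★ `F0P3cStCharTSRootPersist` P1 + ★ `F0P3cStCharTSRootCalculus` §3)

Cell `pub/hodgecm-mathlib`, crux H413 = `stmt-HodgeConjecture-24833` (lane `--supports … --as helper`), route HCCMUnconditional; seat LH4-p03 (g7).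
THEOREMS ONLY over ★ `Summits…Theorems.F0P3cStCharTSRootPersist`; no definition ∕ instance ∕ notation ∕ named fact ∕ `sorry`.
Consumer (datum road MAP-DATUM-ROAD v4, slice S13b «UPR-LC» road (I)(β), F0P3-p02 (g20) 2026-09-02T12:58Z): at `Y := U(Φ₃)(L⁺_v)`, `f y := charpoly y`
(coefficients continuous in `y`), `a := u₀` a norm-one root of `charpoly x₀` — the MOVING ROOT `u(y)` with `u(x₀) = u₀`, continuous at `x₀`, a root of
`charpoly y` and the ONLY root in a fixed window `‖· − u₀‖ < δ` for all `y` near `x₀`.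

THE MATHEMATICS (`K` a complete normed field; `Y` any topological space, `y₀ ∈ Y`, `f : Y → K[X]` with `natDegree (f y) < N` near `y₀` and every
coefficient `y ↦ (f y)_i` continuous at `y₀`; `a` a SIMPLE root of `f y₀`).
* §1 `eventually_forall_norm_coeff_sub_lt`: for every `ρ > 0`, eventually `‖(f y)_i − (f y₀)_i‖ < ρ` for ALL `i` (finitely many `i < N` by continuity,
  the rest vanish — Mathlib `Filter.eventually_all_finset`, `coeff_eq_zero_of_natDegree_lt`).
* §2 `exists_continuousAt_root`: there are a window `δ > 0` and `u : Y → K` with `u y₀ = a`, `u` continuous at `y₀`, and eventually: `(f y)(u y) = 0`,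
  `‖u y − a‖ < δ`, and every root of `f y` in the window equals `u y` (`δ` = the uniqueness radius of ★ `exists_root_unique_near`; existence and
  continuity from ★ P1 with shrinking targets `η`).
HONEST LABEL: HC_CM is proved only modulo the 7 printed citations (2 remaining named inputs: hLiu418 = `stmt-HodgeConjecture-24832`, h413 =
`stmt-HodgeConjecture-24833`) until rung 0 closes; this file closes no organ (count-neutral datum-road brick).

## References
* [Gouvea1993PadicNumbers] F. Q. Gouvêa, *p-adic Numbers*, Universitext (1993∕1997), §3.4 (Newton's method), §6.8 (continuity of roots).
* [Rogawski1990] J. D. Rogawski, *Automorphic Representations of Unitary Groups in Three Variables*, Ann. of Math. Stud. 123 (1990), §12.5 pp. 182–184.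
-/

set_option autoImplicit false
-- the mandated namespace has the single-problem summit's repeated segment (`HodgeConjecture.HodgeConjecture`)
set_option linter.dupNamespace false

noncomputable section

open Polynomial Filter Topology Metric Set
open Summit.HodgeConjecture.HodgeConjecture.Cruxes.H413.F0P3cStCharTSRootCalculus (exists_root_unique_near)
open Summit.HodgeConjecture.HodgeConjecture.Cruxes.H413.F0P3cStCharTSRootPersist (exists_root_near_of_simple_root)

namespace Summit.HodgeConjecture.HodgeConjecture.Cruxes.H413.F0P3cStCharTSMovingRoot

variable {K : Type*} [NormedField K] {Y : Type*} [TopologicalSpace Y] {y₀ : Y}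

/-! ## §1 Coefficientwise closeness from coefficientwise continuity -/

/-- If `natDegree (f y) < N` near `y₀` and each coefficient `y ↦ (f y)_i` is continuous at `y₀`, then for every `ρ > 0` eventually ALL coefficients of
`f y` are within `ρ` of those of `f y₀` (the coefficients of index `≥ N` vanish on both sides). [folklore] -/
theorem eventually_forall_norm_coeff_sub_lt (f : Y → K[X]) {N : ℕ} (hdeg : ∀ᶠ y in 𝓝 y₀, (f y).natDegree < N)
    (hcoeff : ∀ i, ContinuousAt (fun y => (f y).coeff i) y₀) {ρ : ℝ} (hρ : 0 < ρ) :
    ∀ᶠ y in 𝓝 y₀, ∀ i, ‖(f y).coeff i - (f y₀).coeff i‖ < ρ := by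
  have h₀ : (f y₀).natDegree < N := hdeg.self_of_nhds
  have hfin : ∀ᶠ y in 𝓝 y₀, ∀ i ∈ Finset.range N, ‖(f y).coeff i - (f y₀).coeff i‖ < ρ := by
    rw [Filter.eventually_all_finset]
    intro i _
    have h := Metric.tendsto_nhds.1 (hcoeff i) ρ hρ
    refine h.mono fun y hy => ?_
    rwa [dist_eq_norm] at hy
  filter_upwards [hdeg, hfin] with y hy hyfin
  intro i
  by_cases hi : i < N
  · exact hyfin i (Finset.mem_range.2 hi)
  · rw [not_lt] at hi
    rw [coeff_eq_zero_of_natDegree_lt (lt_of_lt_of_le hy hi), coeff_eq_zero_of_natDegree_lt (lt_of_lt_of_le h₀ hi),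
      sub_zero, norm_zero]
    exact hρ

/-! ## §2 The moving root -/

/-- **The moving root (MOVING-ROOT★).**  `K` complete; `f : Y → K[X]` with `natDegree (f y) < N` near `y₀` and coefficients continuous at `y₀`; `a` a root
of `f y₀` with `(f y₀)′(a) ≠ 0`.  Then there are a window `δ > 0` and `u : Y → K` with `u y₀ = a`, `u` continuous at `y₀`, and for all `y` near `y₀`:
`u y` is a root of `f y` with `‖u y − a‖ < δ`, and it is the ONLY root of `f y` in that window. [folklore] -/
theorem exists_continuousAt_root [CompleteSpace K] (f : Y → K[X]) {N : ℕ} (hdeg : ∀ᶠ y in 𝓝 y₀, (f y).natDegree < N)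
    (hcoeff : ∀ i, ContinuousAt (fun y => (f y).coeff i) y₀) {a : K} (ha₀ : (f y₀).IsRoot a) (ha : (derivative (f y₀)).eval a ≠ 0) :
    ∃ (δ : ℝ) (u : Y → K), 0 < δ ∧ u y₀ = a ∧ ContinuousAt u y₀ ∧
      ∀ᶠ y in 𝓝 y₀, (f y).IsRoot (u y) ∧ ‖u y - a‖ < δ ∧ ∀ r, (f y).IsRoot r → ‖r - a‖ < δ → r = u y := by
  classical
  have h₀ : (f y₀).natDegree < N := hdeg.self_of_nhds
  -- the window `δ` = uniqueness radius; existence radius `ρe` for the target `δ`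
  obtain ⟨δ, hδ, huniq⟩ := exists_root_unique_near h₀ ha
  obtain ⟨ρe, hρe, hex⟩ := exists_root_near_of_simple_root h₀ ha₀ ha hδ
  -- the root selector
  set u : Y → K := fun y => if h : ∃ r, (f y).IsRoot r ∧ ‖r - a‖ < δ then h.choose else a with hu
  have hu_spec : ∀ y, (∃ r, (f y).IsRoot r ∧ ‖r - a‖ < δ) → (f y).IsRoot (u y) ∧ ‖u y - a‖ < δ := by
    intro y h
    have h1 : u y = h.choose := by simp only [hu, dif_pos h]
    rw [h1]
    exact h.choose_spec
  -- uniqueness in the window for `y` with coefficients within `δ`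
  have hwin : ∀ y, (f y).natDegree < N → (∀ i, ‖(f y).coeff i - (f y₀).coeff i‖ < δ) →
      ∀ r, (f y).IsRoot r → ‖r - a‖ < δ → r = u y := by
    intro y hyN hyc r hr hra
    obtain ⟨hur, hua⟩ := hu_spec y ⟨r, hr, hra⟩
    exact huniq (f y) hyN hyc r (u y) hr hur hra hua
  have hself : ∀ i, ‖(f y₀).coeff i - (f y₀).coeff i‖ < δ := fun i => by rw [sub_self, norm_zero]; exact hδ
  have hu0 : u y₀ = a := (hwin y₀ h₀ hself a ha₀ (by rw [sub_self, norm_zero]; exact hδ)).symm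
  refine ⟨δ, u, hδ, hu0, ?_, ?_⟩
  · -- continuity at `y₀`: the root of ★ P1 within `min ε δ` IS `u y` by uniqueness in the window
    rw [ContinuousAt, Metric.tendsto_nhds, hu0]
    intro ε hε
    obtain ⟨ρε, hρε, hexε⟩ := exists_root_near_of_simple_root h₀ ha₀ ha (lt_min hε hδ)
    filter_upwards [hdeg, eventually_forall_norm_coeff_sub_lt f hdeg hcoeff (lt_min hρε hδ)] with y hyN hyc
    obtain ⟨r, hr, hra⟩ := hexε (f y) hyN fun i => lt_of_lt_of_le (hyc i) (min_le_left _ _)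
    have hru : r = u y :=
      hwin y hyN (fun i => lt_of_lt_of_le (hyc i) (min_le_right _ _)) r hr (lt_of_lt_of_le hra (min_le_right _ _))
    rw [dist_eq_norm, ← hru]
    exact lt_of_lt_of_le hra (min_le_left _ _)
  · -- eventually: a root in the window exists (★ P1), `u y` is it, and it is unique there
    filter_upwards [hdeg, eventually_forall_norm_coeff_sub_lt f hdeg hcoeff (lt_min hρe hδ)] with y hyN hyc
    obtain ⟨r, hr, hra⟩ := hex (f y) hyN fun i => lt_of_lt_of_le (hyc i) (min_le_left _ _)
    obtain ⟨hur, hua⟩ := hu_spec y ⟨r, hr, hra⟩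
    exact ⟨hur, hua, fun r' hr' hr'a => hwin y hyN (fun i => lt_of_lt_of_le (hyc i) (min_le_right _ _)) r' hr' hr'a⟩

/-- **The moving root — eventual form of continuity** (for consumers who want `‖u y − a‖ < η` as an `Eventually`): with `δ, u` as in
`exists_continuousAt_root`, for every `η > 0` eventually `‖u y − a‖ < η`. [folklore] -/
theorem eventually_norm_sub_lt_of_continuousAt {u : Y → K} {a : K} (hu0 : u y₀ = a) (hu : ContinuousAt u y₀) {η : ℝ} (hη : 0 < η) :
    ∀ᶠ y in 𝓝 y₀, ‖u y - a‖ < η := by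
  have h := Metric.tendsto_nhds.1 hu η hη
  refine h.mono fun y hy => ?_
  rwa [dist_eq_norm, hu0] at hy

end Summit.HodgeConjecture.HodgeConjecture.Cruxes.H413.F0P3cStCharTSMovingRoot

end
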